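import Summits.NavierStokesRegularity.NavierStokesRegularity.Theorems.PerpetualPumpAveragedTypeIBlowupDieGlobalUnique
import Summits.NavierStokesRegularity.NavierStokesRegularity.Theorems.PerpetualPumpAveragedTypeIBlowupChainContinuation

/-!
# Crux `PerpetualPump.AveragedTypeIBlowup` (stmt-NavierStokesRegularity-1835), line `Sketch`:
# the stub `extendOfApriori` — the continuation principle for the Volterra chain

T. Tao, *Finite time blowup for an averaged three-dimensional Navier–Stokes equation*, J. Amer.
Math. Soc. **29** (2016), 601–674 = arXiv:1402.0290v3, §4 p. 22 (4.14): the wavelet coefficients of a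
mild solution of the cascade equation solve the exact Volterra chain
`Y_{i,n}(t) = A 1_{(i,n)=(i₀,n₀)} k_{i,n}(t) + ∫₀ᵗ k_{i,n}(t-s) quadTerm(Y)_{i,n}(s) ds` with continuous
kernels `|k_{i,n}| ≤ 1`.

This file proves the registered stub `stub_extendOfApriori` of the lead's skeleton
`Cruxes/AveragedTypeIBlowup/Lines/Sketch.lean`, verbatim — the CONTINUATION PRINCIPLE used by the
window one-step theorem of the line: a chain solution `Y` on `[0,S)` (continuous on `[0,S)`, no modes
below `n₀`, `(1+ε₀)^{20n}`-bounded on compact sub-intervals) extends strictly beyond `Tmax ≥ S` provided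
EVERY chain solution on `[0,T)`, `S ≤ T ≤ Tmax`, agreeing with `Y` on `[0,S)` obeys an a-priori bound
of the `H¹⁰` size `sup (1+ε₀)^{10n}|Y'_{i,n}(t)|` on `[0,T)`.

The argument is the pattern of the landed `dieGlobal_of_kernel`: if no solution lives beyond `Tmax`,
the lifespans `T ≥ S` of the chain solutions form a nonempty set bounded by `Tmax`; the solutions glue
to one on `[0, sup)` (`chain_glue`), which agrees with `Y` on `[0,S)` (`chain_unique`), is therefore
`H¹⁰`-bounded on `[0, sup)` by the hypothesis, and extends past `sup` (`chainContinuation_of_kernel`) —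
a contradiction.

Nothing here changes a statement of the route; the file lands with `--supports`.

## References

* T. Tao, J. Amer. Math. Soc. 29 (2016), 601–674, arXiv:1402.0290v3, §4 Lemma 4.1, p. 22 (4.14).
  [`Tao2016AveragedNS`]
-/

noncomputable section

-- the summit namespace `…NavierStokesRegularity.NavierStokesRegularity…` is the tree convention
set_option linter.dupNamespace false

open MeasureTheory Set Filter Topology
open scoped ENNReal
open Literature.Analysis.FluidPDE Literature.Analysis.FluidPDE.Tao2016
open Literature.Analysis.FluidPDE.TaoCascade (quadTerm IsSymmetricCoeff IsCancellingCoeff)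
open Literature.Analysis.FluidPDE.TaoCascade (shiftSet)

namespace Summit.NavierStokesRegularity.NavierStokesRegularity.Theorems.PerpetualPumpAveragedTypeIBlowup

/-! ### The registered stub -/

/-- **Stub `extendOfApriori`** (registered stub of the line `Sketch` of the crux
`PerpetualPump.AveragedTypeIBlowup`, verbatim): the continuation principle for the exact Volterra chain
`Y_{i,n}(t) = A 1_{(i,n)=(i₀,n₀)} k_{i,n}(t) + ∫₀ᵗ k_{i,n}(t-s) quadTerm(Y)_{i,n}(s) ds` with abstract
continuous kernels `|k_{i,n}| ≤ 1`. If EVERY chain solution on `[0,T)`, `S ≤ T ≤ Tmax`, that agrees with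
the given solution `Y` on `[0,S)` is a-priori bounded in the `H¹⁰` weight on `[0,T)`, then `Y` extends to
a chain solution on some `[0,T'')` with `T'' > Tmax`. Otherwise the lifespans `T ≥ S` of the chain
solutions form a nonempty set bounded by `Tmax`; the solutions glue to one on `[0, sup)` (`chain_glue`),
which agrees with `Y` on `[0,S)` (`chain_unique`), is `H¹⁰`-bounded on `[0, sup)` by hypothesis and so
extends past `sup` (`chainContinuation_of_kernel`) — a contradiction; exactly the pattern of
`dieGlobal_of_kernel`. [cite: Tao2016AveragedNS, §4 p. 22 (4.14)] -/
theorem stub_extendOfApriori :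
    ∀ {ε₀ : ℝ}, 0 < ε₀ → ∀ {m : ℕ} (α : Fin m → Fin m → Fin m → ℤ × ℤ × ℤ → ℝ)
      (k : Fin m → ℤ → ℝ → ℝ), (∀ i n τ, |k i n τ| ≤ 1) → (∀ i n, Continuous (k i n)) →
      ∀ (i₀ : Fin m) (n₀ : ℤ) (A S Tmax : ℝ) (Y : Fin m → ℤ → ℝ → ℝ), 0 < S → S ≤ Tmax →
      (∀ i n, ContinuousOn (Y i n) (Ico 0 S)) →
      (∀ i n t, n < n₀ → Y i n t = 0) →
      (∀ S' : ℝ, S' < S → ∃ C : ℝ, ∀ (i : Fin m) (n : ℤ), ∀ t ∈ Icc 0 S',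
        (1 + ε₀) ^ ((20 : ℝ) * n) * |Y i n t| ≤ C) →
      (∀ (i : Fin m) (n : ℤ), ∀ t ∈ Ico 0 S,
        Y i n t = (if i = i₀ ∧ n = n₀ then A else 0) * k i n t +
          ∫ s in (0 : ℝ)..t, k i n (t - s) * quadTerm ε₀ α Y i n s) →
      (∀ (T : ℝ) (Y' : Fin m → ℤ → ℝ → ℝ), S ≤ T → T ≤ Tmax →
        (∀ i n, ContinuousOn (Y' i n) (Ico 0 T)) →
        (∀ i n t, n < n₀ → Y' i n t = 0) →
        (∀ S' : ℝ, S' < T → ∃ C : ℝ, ∀ (i : Fin m) (n : ℤ), ∀ t ∈ Icc 0 S',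
          (1 + ε₀) ^ ((20 : ℝ) * n) * |Y' i n t| ≤ C) →
        (∀ (i : Fin m) (n : ℤ), ∀ t ∈ Ico 0 T,
          Y' i n t = (if i = i₀ ∧ n = n₀ then A else 0) * k i n t +
            ∫ s in (0 : ℝ)..t, k i n (t - s) * quadTerm ε₀ α Y' i n s) →
        (∀ (i : Fin m) (n : ℤ), ∀ t ∈ Ico 0 S, Y' i n t = Y i n t) →
        ∃ C : ℝ, ∀ (i : Fin m) (n : ℤ), ∀ t ∈ Ico 0 T, (1 + ε₀) ^ ((10 : ℝ) * n) * |Y' i n t| ≤ C) →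
      ∃ (T'' : ℝ) (Y'' : Fin m → ℤ → ℝ → ℝ), Tmax < T'' ∧
        (∀ i n, ContinuousOn (Y'' i n) (Ico 0 T'')) ∧
        (∀ i n t, n < n₀ → Y'' i n t = 0) ∧
        (∀ S' : ℝ, S' < T'' → ∃ C : ℝ, ∀ (i : Fin m) (n : ℤ), ∀ t ∈ Icc 0 S',
          (1 + ε₀) ^ ((20 : ℝ) * n) * |Y'' i n t| ≤ C) ∧
        (∀ (i : Fin m) (n : ℤ), ∀ t ∈ Ico 0 T'',
          Y'' i n t = (if i = i₀ ∧ n = n₀ then A else 0) * k i n t +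
            ∫ s in (0 : ℝ)..t, k i n (t - s) * quadTerm ε₀ α Y'' i n s) ∧
        ∀ (i : Fin m) (n : ℤ), ∀ t ∈ Ico 0 S, Y'' i n t = Y i n t := by
  intro ε₀ hε₀ m α k hka hkc i₀ n₀ A S Tmax Y hS hSTmax hcont hlow hdec hchain hapr
  by_contra hcon
  -- the lifespans `T ≥ S` of the chain solutions (they all agree with `Y` on `[0, S)`)
  set 𝒯 : Set ℝ := {T | S ≤ T ∧ ∃ Y' : Fin m → ℤ → ℝ → ℝ,
    (∀ i n, ContinuousOn (Y' i n) (Ico 0 T)) ∧ (∀ i n t, n < n₀ → Y' i n t = 0) ∧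
    (∀ S' : ℝ, S' < T → ∃ C : ℝ, ∀ (i : Fin m) (n : ℤ), ∀ t ∈ Icc 0 S',
      (1 + ε₀) ^ ((20 : ℝ) * n) * |Y' i n t| ≤ C) ∧
    (∀ (i : Fin m) (n : ℤ), ∀ t ∈ Ico 0 T,
      Y' i n t = (if i = i₀ ∧ n = n₀ then A else 0) * k i n t +
        ∫ s in (0 : ℝ)..t, k i n (t - s) * quadTerm ε₀ α Y' i n s)} with h𝒯
  -- under the contradiction hypothesis no lifespan exceeds `Tmax`
  have hle : ∀ T ∈ 𝒯, T ≤ Tmax := by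
    rintro T ⟨hST, Y', hc, hl, hd, hch⟩
    by_contra h
    push Not at h
    exact hcon ⟨T, Y', h, hc, hl, hd, hch,
      fun i n t ht => chain_unique hε₀ α k hka hkc i₀ n₀ A hc hl hd hch hcont hlow hdec hchain i n t
        ⟨ht.1, lt_min (ht.2.trans_le hST) ht.2⟩⟩
  have hS𝒯 : S ∈ 𝒯 := ⟨le_rfl, Y, hcont, hlow, hdec, hchain⟩
  have hne : 𝒯.Nonempty := ⟨S, hS𝒯⟩
  have hbdd : BddAbove 𝒯 := ⟨Tmax, hle⟩
  have hST₁ : S ≤ sSup 𝒯 := le_csSup hbdd hS𝒯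
  have hsupTmax : sSup 𝒯 ≤ Tmax := csSup_le hne hle
  -- the glued solution on `[0, sup 𝒯)`; it agrees with `Y` on `[0, S)`
  obtain ⟨Yg, hgcont, hglow, hgdec, hgchain⟩ :=
    chain_glue hε₀ α k hka hkc i₀ n₀ A hne fun T hT => hT.2
  have hgY : ∀ (i : Fin m) (n : ℤ), ∀ t ∈ Ico 0 S, Yg i n t = Y i n t := fun i n t ht =>
    chain_unique hε₀ α k hka hkc i₀ n₀ A hgcont hglow hgdec hgchain hcont hlow hdec hchain i n t
      ⟨ht.1, lt_min (ht.2.trans_le hST₁) ht.2⟩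
  -- hence, by the a-priori hypothesis, it is `H¹⁰`-bounded and extends past `sup 𝒯`: a contradiction
  obtain ⟨C, hC⟩ := hapr (sSup 𝒯) Yg hST₁ hsupTmax hgcont hglow hgdec hgchain hgY
  obtain ⟨T', Y'', hT', hc'', hl'', hd'', hch'', -⟩ := chainContinuation_of_kernel hε₀ α k hka
    hkc i₀ n₀ A (sSup 𝒯) Yg (hS.trans_le hST₁) hgcont hglow hgchain ⟨C, hC⟩
  have hT'𝒯 : T' ∈ 𝒯 := ⟨hST₁.trans hT'.le, Y'', hc'', hl'', hd'', hch''⟩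
  exact (lt_irrefl _) (hT'.trans_le (le_csSup hbdd hT'𝒯))

end Summit.NavierStokesRegularity.NavierStokesRegularity.Theorems.PerpetualPumpAveragedTypeIBlowup

end
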